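import Literature.ModelTheory.FiniteModelTheory.ESOTableau
import HarnessLib

/-!
# Fagin's theorem, hard direction `NP ⊆ ∃SO`: the tableau sentence and the discharge of
`NP_subset_eso`

Topic `Literature/ModelTheory/FiniteModelTheory`; continues `ESOTableau.lean` and PROVES the
named fact `Literature.ModelTheory.FiniteModelTheory.NP_subset_eso` of `Fagin.lean`
(`NP_subset_eso_holds`; Libkin 2004, proof of Thm. 9.6, second part, pp. 170–173: "every NP
property of finite structures can be expressed in `∃SO`"; Immerman 1999, Thm. 7.8; Fagin 1974).
With the easy direction `eso_subset_NP_holds` (`ESOVerifier.lean`) this yields Fagin's theorem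
`fagin_theorem_holds` (`ESOProofs.lean`).

* The nine Cook–Levin families (`FaginClauses.lean`, Sipser 2012, Thm. 7.37: start row — input
  bits through the input formula `ι` = `InputBitP` of `ESOInputBits.lean`, constants,
  certificate cells, empty tail; move — the tabulated local rules `topF`/`intF` of
  `TableauStep.lean` as finite conjunctions, empty bottom; exactly-one; accept) as QUERIES
  `Tab1 … Tab9` over the guessed arithmetic and the tableau layout, rows/blocks/positions being
  `K`-tuples; `TabP` (Libkin's `Ψ`) and the closed query `faginQ R W := ArithAxP W ∧ TabP W R`
  (Libkin's sentence (9.1) with the arithmetic of p. 172 guessed alongside the order);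
* DEFINABILITY (`JQuery.isDef_tab1 … isDef_tab9`, `isDef_tabP`, `isDef_faginQ`) from the
  closure properties of `ESODefinability.lean`;
* CORRECTNESS over standard arithmetic (`tab1_iff … tab9_iff`, `tabP_iff`): for a width `K`
  bounding the master numeral, `TabP W R ↔ ClausesHoldS M (code of R) P T (σ read off W)`;
* ASSEMBLY `mem_iff_exists_faginQ` (⇒ standard tables on top of the tables of a satisfying
  assignment; ⇐ normalise the guessed order by a relabelling `π` of `Fin n` —
  `exists_relabel_isStdArith`, invariance of first-order queries `JQuery.IsDef.invariant` — read
  the assignment `assignOf` off the tables, get `⟨n, π·R⟩ ∈ C` and use isomorphism-closure), and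
  `NP_subset_eso_holds` (`exists_clausesHold_of_mem_NP`, `exists_width`, small structures
  hard-wired by `IsESODefinable.of_eventually`). Non-degeneracy of the vocabulary is not used in
  this direction.

The families `Tab1 … Tab9` and `TabP` are first-order QUERIES — predicates of the witness tables
`W` (and, for `Tab1`/`TabP`, of the input tables `R`), written with these arguments as explicit
binders — not closed propositions: no `TabN_holds` exists or could (over the standard arithmetic
on top of empty tableau tables `Tab8` already fails, by `tab8_iff`). What is proved about them is
definability (`JQuery.isDef_tabN`) and correctness over standard arithmetic (`tabN_iff`).

## References

* L. Libkin, *Elements of Finite Model Theory*, Springer 2004, Thm. 9.6 and its proof,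
  pp. 169–173, (9.1) (printed pages; PDF = printed + 18 in the held copy).
* N. Immerman, *Descriptive Complexity*, Springer 1999, Thm. 7.8 (`SO∃ = NP`).
* R. Fagin, *Generalized first-order spectra and polynomial-time recognizable sets*, in:
  Complexity of Computation, SIAM–AMS Proc. 7 (1974), 43–73.
* M. Sipser, *Introduction to the Theory of Computation*, 3rd ed., Cengage 2012, Thm. 7.37.
-/

namespace Literature.ModelTheory.FiniteModelTheory

open _root_.Computability Literature.Computability.Complexity
  Literature.Computability.Complexity.Tableau Literature.Computability.Cryptography NExpr

/-! ### The nine families as queries over guessed arithmetic and the tableau layout -/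

section Families

variable (M : Turing.TM2ComputableAux Bool Bool) (ar : List ℕ) (K : ℕ) (p q : Polynomial ℕ)
  (hK : ∀ s : Fin ar.length, ar.get s ≤ K) {n : ℕ}

attribute [local instance] Turing.FinTM2.kFin Turing.FinTM2.ΛFin Turing.FinTM2.σFin
  Turing.FinTM2.Γk₀Fin

local notation "d" => dM M
local notation "TW" => RelTables (arithWit K (tabWit M K))

/-- Family 1 (START ROW, INPUT BITS): blocks `2i + 1`, `2i + 2` of row `0` hold the doubled bit
`i` of the code of the input structure — the only family reading the INPUT relations, through
the formula `ι` (`InputBitP`). [Libkin 2004, proof of Thm. 9.6, p. 172 (`ι`); Sipser 2012,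
Thm. 7.37 (`φ_start`)] [folklore] -/
def Tab1 (W : TW n) (R : RelTables ar n) : Prop :=
  ∀ i : Fin K → Fin n, ∀ b : Bool, InputBitP W R hK i b →
    AtN W (symVal M b) (const 0) [] (const 1) [i, i] ∧
      AtN W (symVal M b) (const 0) [] (const 2) [i, i]

/-- Family 2 (start row, constants): initial control in block `0`, separator `01` in blocks
`2m + 1`, `2m + 2`. [Sipser 2012, Thm. 7.37 (`φ_start`)] [folklore] -/
def Tab2 (W : TW n) : Prop :=
  AtN W (ctrlVal M) (const 0) [] (const 0) [] ∧
    AtN W (symVal M false) (const 0) [] (add (twoME ar) (const 1)) [] ∧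
      AtN W (symVal M true) (const 0) [] (add (twoME ar) (const 2)) []

/-- Family 3 (start row, certificate cells `2m + 3 + j`, `j < P`): an input symbol or empty; once
empty, empty. [Sipser 2012, Thm. 7.37 (`φ_start`)] [folklore] -/
def Tab3 (W : TW n) : Prop :=
  ∀ j : Fin K → Fin n, LtE W j (PE ar p) →
    (AtN W (symVal M false) (const 0) [] (add (twoME ar) (const 3)) [j] ∨
      AtN W (symVal M true) (const 0) [] (add (twoME ar) (const 3)) [j] ∨
        AtN W (noneVal M.tm) (const 0) [] (add (twoME ar) (const 3)) [j]) ∧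
    (AtN W (noneVal M.tm) (const 0) [] (add (twoME ar) (const 3)) [j] →
      AtN W (noneVal M.tm) (const 0) [] (add (twoME ar) (const 4)) [j])

/-- Family 4 (start row, empty tail `NN + 1 + j`, `j < dT + 3d`). [Sipser 2012, Thm. 7.37]
[folklore] -/
def Tab4 (W : TW n) : Prop :=
  ∀ j : Fin K → Fin n, LtE W j (add (dTE ar d p q) (const (3 * d))) →
    AtN W (noneVal M.tm) (const 0) [] (add (NNE ar p) (const 1)) [j]

/-- Family 5 (MOVE, top rule): blocks `0 … 2d` of row `t + 1` from blocks `0 … 3d` of row `t`,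
the finite function `topF` tabulated. [Sipser 2012, Thm. 7.37 (`φ_move`); Libkin 2004, p. 171
("the predicates `Tᵢ` and `H_q` respect the transitions of `M`")] [folklore] -/
def Tab5 (W : TW n) : Prop :=
  ∀ t : Fin K → Fin n, LtE W t (TE ar p q) →
    ∀ (a : Fin (3 * d + 1) → Val M.tm) (r : Fin (2 * d + 1)),
      (∀ s : Fin (3 * d + 1), AtN W (a s) (const 0) [t] (const s) []) →
        AtN W (topF d a r) (const 1) [t] (const r) []

/-- Family 6 (move, interior rule): block `2d + 1 + j` of row `t + 1` from the head blocks
`0 … d` and the neighbourhood `d + 1 + j … 3d + 1 + j` of row `t`, the finite function `intF`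
tabulated. [Sipser 2012, Thm. 7.37 (`φ_move`); Libkin 2004, p. 171] [folklore] -/
def Tab6 (W : TW n) : Prop :=
  ∀ t : Fin K → Fin n, LtE W t (TE ar p q) → ∀ j : Fin K → Fin n, LtE W j (NNdTE ar d p q) →
    ∀ (h : Fin (d + 1) → Val M.tm) (nb : Fin (2 * d + 1) → Val M.tm),
      (∀ s : Fin (d + 1), AtN W (h s) (const 0) [t] (const s) []) →
      (∀ s : Fin (2 * d + 1), AtN W (nb s) (const 0) [t] (const (d + 1 + s)) [j]) →
        AtN W (intF d h nb) (const 1) [t] (const (2 * d + 1)) [j]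

/-- Family 7 (move, bottom): the last `d` blocks of row `t + 1` are empty.
[Sipser 2012, Thm. 7.37] [folklore] -/
def Tab7 (W : TW n) : Prop :=
  ∀ t : Fin K → Fin n, LtE W t (TE ar p q) → ∀ r : Fin d,
    AtN W (noneVal M.tm) (const 1) [t] (add (NNdTE ar d p q) (const (2 * d + 1 + r))) []

/-- Family 8 (CELL): every block of every row holds exactly one value.
[Sipser 2012, Thm. 7.37 (`φ_cell`)] [folklore] -/
def Tab8 (W : TW n) : Prop :=
  ∀ t : Fin K → Fin n, LeE W t (TE ar p q) → ∀ J : Fin K → Fin n, LeE W J (S1E ar d p q) →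
    (∃ v : Val M.tm, AtN W v (const 0) [t] (const 0) [J]) ∧
      ∀ vv : Val M.tm × Val M.tm, vv.1 = vv.2 ∨
        ¬ (AtN W vv.1 (const 0) [t] (const 0) [J] ∧ AtN W vv.2 (const 0) [t] (const 0) [J])

/-- Family 9 (ACCEPT): block `1` of row `T` is the accepting output cell.
[Sipser 2012, Thm. 7.37 (`φ_accept`)] [folklore] -/
def Tab9 (W : TW n) : Prop :=
  AtN W (accVal M) (TE ar p q) [] (const 1) []

/-- **The tableau query `Ψ`** (the first-order part of Libkin's sentence (9.1) after the
order and arithmetic axioms): the nine Cook–Levin families over guessed arithmetic.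
[Libkin 2004, proof of Thm. 9.6, (9.1) and pp. 171–173; Immerman 1999, Thm. 7.8] [folklore] -/
def TabP (W : TW n) (R : RelTables ar n) : Prop :=
  Tab1 M ar K hK W R ∧ Tab2 M ar K W ∧ Tab3 M ar K p W ∧ Tab4 M ar K p q W ∧ Tab5 M ar K p q W ∧
    Tab6 M ar K p q W ∧ Tab7 M ar K p q W ∧ Tab8 M ar K p q W ∧ Tab9 M ar K p q W

/-- **Fagin's sentence** `∃ L ∃ PLUS TIMES EXP2 ∃ (S_v)_v (arithmetic axioms ∧ Ψ)` as a closed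
query: witnesses = the arithmetic layout on top of the tableau layout.
[Libkin 2004, proof of Thm. 9.6, (9.1)] [folklore] -/
def faginQ : JQuery ar (arithWit K (tabWit M K)) Empty :=
  fun _ R W _ => ArithAxP W ∧ TabP M ar K p q hK W R

end Families

/-! ### Definability of the families -/

namespace JQuery

variable (M : Turing.TM2ComputableAux Bool Bool) (ar : List ℕ) (K : ℕ) (p q : Polynomial ℕ)
  (hK : ∀ s : Fin ar.length, ar.get s ≤ K)

attribute [local instance] Turing.FinTM2.kFin Turing.FinTM2.ΛFin Turing.FinTM2.σFin
  Turing.FinTM2.Γk₀Fin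

local notation "d" => dM M
local notation "TW" => RelTables (arithWit K (tabWit M K))

/-- Family 1 is definable. [folklore] -/
theorem isDef_tab1 : IsDef (fun _ (R : RelTables ar _) (W : TW _) (_ : Empty → _) => Tab1 M ar K hK W R) :=
  ((IsDef.iInf fun b : Bool => (isDef_inputBitP (rest := tabWit M K) hK
    (Sum.inr : Fin K → Empty ⊕ Fin K) b).imp
      ((isDef_atN (symVal M b) (const 0) [] (const 1) [Sum.inr, Sum.inr]).and
        (isDef_atN (symVal M b) (const 0) [] (const 2) [Sum.inr, Sum.inr]))).alls).of_iff
    fun _ _ _ _ => Iff.rfl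

/-- Family 2 is definable. [folklore] -/
theorem isDef_tab2 : IsDef (fun _ (_ : RelTables ar _) (W : TW _) (_ : Empty → _) => Tab2 M ar K W) :=
  ((isDef_atN (ctrlVal M) (const 0) ([] : List (Fin K → Empty)) (const 0) []).and
    ((isDef_atN (symVal M false) (const 0) ([] : List (Fin K → Empty)) (add (twoME ar) (const 1)) []).and
      (isDef_atN (symVal M true) (const 0) ([] : List (Fin K → Empty)) (add (twoME ar) (const 2)) []))).of_iff
    fun _ _ _ _ => Iff.rfl

/-- Family 3 is definable. [folklore] -/
theorem isDef_tab3 : IsDef (fun _ (_ : RelTables ar _) (W : TW _) (_ : Empty → _) => Tab3 M ar K p W) := by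
  let j : Fin K → Empty ⊕ Fin K := Sum.inr
  have h3 := fun v : Val M.tm =>
    isDef_atN (ar := ar) (M := M) v (const 0) ([] : List (Fin K → Empty ⊕ Fin K))
      (add (twoME ar) (const 3)) [j]
  have h4 := isDef_atN (ar := ar) (M := M) (noneVal M.tm) (const 0)
    ([] : List (Fin K → Empty ⊕ Fin K)) (add (twoME ar) (const 4)) [j]
  exact (((isDef_ltE (rest := tabWit M K) j (PE ar p)).imp
    (((h3 _).or ((h3 _).or (h3 _))).and ((h3 _).imp h4))).alls).of_iff fun _ _ _ _ => Iff.rfl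

/-- Family 4 is definable. [folklore] -/
theorem isDef_tab4 : IsDef (fun _ (_ : RelTables ar _) (W : TW _) (_ : Empty → _) => Tab4 M ar K p q W) :=
  (((isDef_ltE (rest := tabWit M K) (Sum.inr : Fin K → Empty ⊕ Fin K)
    (add (dTE ar d p q) (const (3 * d)))).imp
    (isDef_atN (noneVal M.tm) (const 0) [] (add (NNE ar p) (const 1)) [Sum.inr])).alls).of_iff
    fun _ _ _ _ => Iff.rfl

/-- Family 5 is definable (a finite conjunction over the tabulated arguments of `topF`).
[folklore] -/
theorem isDef_tab5 : IsDef (fun _ (_ : RelTables ar _) (W : TW _) (_ : Empty → _) => Tab5 M ar K p q W) :=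
  (((isDef_ltE (rest := tabWit M K) (Sum.inr : Fin K → Empty ⊕ Fin K) (TE ar p q)).imp
    (IsDef.iInf fun a : Fin (3 * d + 1) → Val M.tm => IsDef.iInf fun r : Fin (2 * d + 1) =>
      (IsDef.iInf fun s : Fin (3 * d + 1) =>
        isDef_atN (ar := ar) (a s) (const 0) [Sum.inr] (const s) []).imp
        (isDef_atN (topF d a r) (const 1) [Sum.inr] (const r) []))).alls).of_iff
    fun _ _ _ _ => Iff.rfl

/-- Family 6 is definable. [folklore] -/
theorem isDef_tab6 : IsDef (fun _ (_ : RelTables ar _) (W : TW _) (_ : Empty → _) => Tab6 M ar K p q W) := by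
  let t : Fin K → (Empty ⊕ Fin K) ⊕ Fin K := fun i => Sum.inl (Sum.inr i)
  let j : Fin K → (Empty ⊕ Fin K) ⊕ Fin K := Sum.inr
  have hin : IsDef (fun _ (_ : RelTables ar _) (W : TW _) (v : (Empty ⊕ Fin K) ⊕ Fin K → _) =>
      LtE W (v ∘ j) (NNdTE ar d p q) →
      ∀ (h : Fin (d + 1) → Val M.tm) (nb : Fin (2 * d + 1) → Val M.tm),
        (∀ s : Fin (d + 1), AtN W (h s) (const 0) [v ∘ t] (const s) []) →
        (∀ s : Fin (2 * d + 1), AtN W (nb s) (const 0) [v ∘ t] (const (d + 1 + s)) [v ∘ j]) →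
          AtN W (intF d h nb) (const 1) [v ∘ t] (const (2 * d + 1)) [v ∘ j]) :=
    ((isDef_ltE j (NNdTE ar d p q)).imp
      (IsDef.iInf fun h : Fin (d + 1) → Val M.tm => IsDef.iInf fun nb : Fin (2 * d + 1) → Val M.tm =>
        (IsDef.iInf fun s : Fin (d + 1) => isDef_atN (ar := ar) (h s) (const 0) [t] (const s) []).imp
        ((IsDef.iInf fun s : Fin (2 * d + 1) =>
          isDef_atN (ar := ar) (nb s) (const 0) [t] (const (d + 1 + s)) [j]).imp
          (isDef_atN (intF d h nb) (const 1) [t] (const (2 * d + 1)) [j])))).of_iff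
      fun _ _ _ _ => Iff.rfl
  exact (((isDef_ltE (rest := tabWit M K) (Sum.inr : Fin K → Empty ⊕ Fin K) (TE ar p q)).imp
    hin.alls).alls).of_iff fun _ _ _ _ => Iff.rfl

/-- Family 7 is definable. [folklore] -/
theorem isDef_tab7 : IsDef (fun _ (_ : RelTables ar _) (W : TW _) (_ : Empty → _) => Tab7 M ar K p q W) :=
  (((isDef_ltE (rest := tabWit M K) (Sum.inr : Fin K → Empty ⊕ Fin K) (TE ar p q)).imp
    (IsDef.iInf fun r : Fin d => isDef_atN (noneVal M.tm) (const 1) [Sum.inr]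
      (add (NNdTE ar d p q) (const (2 * d + 1 + r))) [])).alls).of_iff
    fun _ _ _ _ => Iff.rfl

/-- Family 8 is definable (finite disjunction / conjunction over block values). [folklore] -/
theorem isDef_tab8 : IsDef (fun _ (_ : RelTables ar _) (W : TW _) (_ : Empty → _) => Tab8 M ar K p q W) := by
  let t : Fin K → (Empty ⊕ Fin K) ⊕ Fin K := fun i => Sum.inl (Sum.inr i)
  let J : Fin K → (Empty ⊕ Fin K) ⊕ Fin K := Sum.inr
  have hat := fun v : Val M.tm => isDef_atN (ar := ar) (M := M) v (const 0) [t] (const 0) [J]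
  have hin : IsDef (fun _ (_ : RelTables ar _) (W : TW _) (v : (Empty ⊕ Fin K) ⊕ Fin K → _) =>
      LeE W (v ∘ J) (S1E ar d p q) →
      (∃ val : Val M.tm, AtN W val (const 0) [v ∘ t] (const 0) [v ∘ J]) ∧
        ∀ vv : Val M.tm × Val M.tm, vv.1 = vv.2 ∨
          ¬ (AtN W vv.1 (const 0) [v ∘ t] (const 0) [v ∘ J] ∧
            AtN W vv.2 (const 0) [v ∘ t] (const 0) [v ∘ J])) :=
    ((isDef_leE J (S1E ar d p q)).imp ((IsDef.iSup hat).and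
      (IsDef.iInf fun vv : Val M.tm × Val M.tm =>
        (isDef_const (vv.1 = vv.2)).or ((hat vv.1).and (hat vv.2)).not))).of_iff
      fun _ _ _ _ => Iff.rfl
  exact (((isDef_leE (rest := tabWit M K) (Sum.inr : Fin K → Empty ⊕ Fin K) (TE ar p q)).imp
    hin.alls).alls).of_iff fun _ _ _ _ => Iff.rfl

/-- Family 9 is definable. [folklore] -/
theorem isDef_tab9 : IsDef (fun _ (_ : RelTables ar _) (W : TW _) (_ : Empty → _) => Tab9 M ar K p q W) :=
  (isDef_atN (accVal M) (TE ar p q) ([] : List (Fin K → Empty)) (const 1) []).of_iff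
    fun _ _ _ _ => Iff.rfl

/-- **`Ψ` is first-order.** [Libkin 2004, proof of Thm. 9.6, pp. 171–173] [folklore] -/
theorem isDef_tabP : IsDef (fun _ (R : RelTables ar _) (W : TW _) (_ : Empty → _) => TabP M ar K p q hK W R) :=
  (isDef_tab1 M ar K hK).and ((isDef_tab2 M ar K).and ((isDef_tab3 M ar K p).and
    ((isDef_tab4 M ar K p q).and ((isDef_tab5 M ar K p q).and ((isDef_tab6 M ar K p q).and
      ((isDef_tab7 M ar K p q).and ((isDef_tab8 M ar K p q).and (isDef_tab9 M ar K p q))))))))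

/-- **Fagin's sentence is an `∃SO` sentence**: the closed query `faginQ` is first-order.
[Libkin 2004, proof of Thm. 9.6, (9.1)] [folklore] -/
theorem isDef_faginQ : (faginQ M ar K p q hK).IsDef :=
  isDef_arithAxP.and (isDef_tabP M ar K p q hK)

end JQuery

/-! ### Correctness of the families over standard arithmetic -/

section Correctness

variable {M : Turing.TM2ComputableAux Bool Bool} {ar : List ℕ} {K : ℕ} {p q : Polynomial ℕ}
  {hK : ∀ s : Fin ar.length, ar.get s ≤ K} {n : ℕ}
  {W : RelTables (arithWit K (tabWit M K)) n} {R : RelTables ar n}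

attribute [local instance] Turing.FinTM2.kFin Turing.FinTM2.ΛFin Turing.FinTM2.σFin
  Turing.FinTM2.Γk₀Fin

local notation "d" => dM M
local notation "σ" => SigmaW (restT W)
local notation "m" => List.length (codeOf R)
local notation "P" => Polynomial.eval (List.length (codeOf R)) p
local notation "T" => faginT p q (List.length (codeOf R))

/-- `atN_iff` with the two index values substituted. [folklore] -/
theorem atN_iff' (hW : IsStdArith W) (hK1 : 1 ≤ K) {v : Val M.tm} {e₁ e₂ : NExpr}
    {us₁ us₂ : List (Fin K → Fin n)} (he₁ : e₁.Bdd n K) (he₂ : e₂.Bdd n K) {a b : ℕ}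
    (ha : e₁.eval n + lsum us₁ = a) (hb : e₂.eval n + lsum us₂ = b) (ha' : a < n ^ K)
    (hb' : b < n ^ K) : AtN W v e₁ us₁ e₂ us₂ ↔ SigmaW (restT W) a b v := by
  subst ha hb; exact atN_iff hW hK1 he₁ he₂ ha' hb'

variable (R)

/-- **Family 1 is the input-bit family.** [Libkin 2004, p. 172; Sipser 2012, Thm. 7.37]
[folklore] -/
theorem tab1_iff (hW : IsStdArith W) (hK1 : 1 ≤ K) (hbd : (boundE ar d p q).Bdd n K) :
    Tab1 M ar K hK W R ↔
      ∀ (i : ℕ) (b : Bool), (codeOf R)[i]? = some b →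
        σ 0 (2 * i + 1) (symVal M b) ∧ σ 0 (2 * i + 2) (symVal M b) := by
  have hm : (codeLenE ar).eval n = m := eval_codeLenE R
  obtain ⟨-, -, -, -, -, -, -, -, hsz, hn, hbig⟩ := bounds_of_boundE hbd hm
  have hNN : NN m P = 2 * m + 2 + P := rfl
  have hlen : m < n ^ K := by omega
  have hc0 : (const 0).Bdd n K := show 0 < n ^ K by omega
  have hc1 : (const 1).Bdd n K := show 1 < n ^ K by omega
  have hc2 : (const 2).Bdd n K := show 2 < n ^ K by omega
  unfold Tab1
  constructor
  · intro h1 i b hib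
    obtain ⟨hi, -⟩ := List.getElem?_eq_some_iff.1 hib
    have hiK : i < n ^ K := by omega
    have hin : InputBitP W R hK (tupOf i hiK) b :=
      (inputBitP_iff hW hK1 hsz hn hlen _ b).2 (by rw [tval_tupOf]; exact hib)
    obtain ⟨ha, ha'⟩ := h1 _ b hin
    exact ⟨(atN_iff' hW hK1 hc0 hc1 (a := 0) (b := 2 * i + 1) (by simp [NExpr.eval])
        (by simp [NExpr.eval]; omega) (by omega) (by omega)).1 ha,
      (atN_iff' hW hK1 hc0 hc2 (a := 0) (b := 2 * i + 2) (by simp [NExpr.eval])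
        (by simp [NExpr.eval]; omega) (by omega) (by omega)).1 ha'⟩
  · intro H i b hin
    have hib := (inputBitP_iff hW hK1 hsz hn hlen i b).1 hin
    obtain ⟨hi, -⟩ := List.getElem?_eq_some_iff.1 hib
    obtain ⟨ha, ha'⟩ := H _ b hib
    exact ⟨(atN_iff' hW hK1 hc0 hc1 (a := 0) (b := 2 * tval i + 1) (by simp [NExpr.eval])
        (by simp [NExpr.eval]; omega) (by omega) (by omega)).2 ha,
      (atN_iff' hW hK1 hc0 hc2 (a := 0) (b := 2 * tval i + 2) (by simp [NExpr.eval])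
        (by simp [NExpr.eval]; omega) (by omega) (by omega)).2 ha'⟩

/-- **Family 2 is the start-row constants.** [Sipser 2012, Thm. 7.37] [folklore] -/
theorem tab2_iff (hW : IsStdArith W) (hK1 : 1 ≤ K) (hbd : (boundE ar d p q).Bdd n K) :
    Tab2 M ar K W ↔
      (σ 0 0 (ctrlVal M) ∧ σ 0 (2 * m + 1) (symVal M false) ∧ σ 0 (2 * m + 2) (symVal M true)) := by
  have hm : (codeLenE ar).eval n = m := eval_codeLenE R
  obtain ⟨-, -, h2mE, -, -, -, -, -, -, hn, hbig⟩ := bounds_of_boundE hbd hm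
  have hNN : NN m P = 2 * m + 2 + P := rfl
  have hc0 : (const 0).Bdd n K := show 0 < n ^ K by omega
  have hc1 : (const 1).Bdd n K := show 1 < n ^ K by omega
  have hc2 : (const 2).Bdd n K := show 2 < n ^ K by omega
  have h2m1 : (add (twoME ar) (const 1)).Bdd n K :=
    ⟨h2mE, hc1, by simp only [NExpr.eval, eval_twoME hm]; omega⟩
  have h2m2 : (add (twoME ar) (const 2)).Bdd n K :=
    ⟨h2mE, hc2, by simp only [NExpr.eval, eval_twoME hm]; omega⟩
  unfold Tab2
  exact and_congr (atN_iff' hW hK1 hc0 hc0 (a := 0) (b := 0) (by simp [NExpr.eval])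
      (by simp [NExpr.eval]) (by omega) (by omega))
    (and_congr (atN_iff' hW hK1 hc0 h2m1 (a := 0) (b := 2 * m + 1) (by simp [NExpr.eval])
      (by simp [NExpr.eval, eval_twoME hm]) (by omega) (by omega))
      (atN_iff' hW hK1 hc0 h2m2 (a := 0) (b := 2 * m + 2) (by simp [NExpr.eval])
      (by simp [NExpr.eval, eval_twoME hm]) (by omega) (by omega)))

/-- **Family 3 is the certificate family.** [Sipser 2012, Thm. 7.37] [folklore] -/
theorem tab3_iff (hW : IsStdArith W) (hK1 : 1 ≤ K) (hbd : (boundE ar d p q).Bdd n K) :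
    Tab3 M ar K p W ↔
      ∀ j : ℕ, j < P →
        (σ 0 (2 * m + 3 + j) (symVal M false) ∨ σ 0 (2 * m + 3 + j) (symVal M true) ∨
          σ 0 (2 * m + 3 + j) (noneVal M.tm)) ∧
        (σ 0 (2 * m + 3 + j) (noneVal M.tm) → σ 0 (2 * m + 4 + j) (noneVal M.tm)) := by
  have hm : (codeLenE ar).eval n = m := eval_codeLenE R
  obtain ⟨-, hPE, h2mE, -, -, -, -, -, -, hn, hbig⟩ := bounds_of_boundE hbd hm
  have hNN : NN m P = 2 * m + 2 + P := rfl
  have hPv : (PE ar p).eval n = P := eval_PE hm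
  have hc0 : (const 0).Bdd n K := show 0 < n ^ K by omega
  have h2m3 : (add (twoME ar) (const 3)).Bdd n K :=
    ⟨h2mE, show 3 < n ^ K by omega, by simp only [NExpr.eval, eval_twoME hm]; omega⟩
  have h2m4 : (add (twoME ar) (const 4)).Bdd n K :=
    ⟨h2mE, show 4 < n ^ K by omega, by simp only [NExpr.eval, eval_twoME hm]; omega⟩
  have e3 : ∀ (v : Val M.tm) (jj : Fin K → Fin n), tval jj < P →
      (AtN W v (const 0) [] (add (twoME ar) (const 3)) [jj] ↔ σ 0 (2 * m + 3 + tval jj) v) :=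
    fun v jj hj => atN_iff' hW hK1 hc0 h2m3 (a := 0) (b := 2 * m + 3 + tval jj) (by simp [NExpr.eval])
      (by simp [NExpr.eval, eval_twoME hm]) (by omega) (by omega)
  have e4 : ∀ (v : Val M.tm) (jj : Fin K → Fin n), tval jj < P →
      (AtN W v (const 0) [] (add (twoME ar) (const 4)) [jj] ↔ σ 0 (2 * m + 4 + tval jj) v) :=
    fun v jj hj => atN_iff' hW hK1 hc0 h2m4 (a := 0) (b := 2 * m + 4 + tval jj) (by simp [NExpr.eval])
      (by simp [NExpr.eval, eval_twoME hm]) (by omega) (by omega)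
  unfold Tab3
  constructor
  · intro h3 j hj
    have hjK : j < n ^ K := by omega
    have hg : LtE W (tupOf j hjK) (PE ar p) := (ltE_iff hW hK1 hPE _).2 (by rw [tval_tupOf, hPv]; exact hj)
    have hj' : tval (tupOf j hjK) < P := by rw [tval_tupOf]; exact hj
    have h := h3 _ hg
    rw [e3 _ _ hj', e3 _ _ hj', e3 _ _ hj', e4 _ _ hj', tval_tupOf] at h
    exact h
  · intro H jj hg
    have hj : tval jj < P := by have := (ltE_iff hW hK1 hPE jj).1 hg; rwa [hPv] at this
    rw [e3 _ _ hj, e3 _ _ hj, e3 _ _ hj, e4 _ _ hj]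
    exact H _ hj

/-- **Family 4 is the empty tail of the start row.** [Sipser 2012, Thm. 7.37] [folklore] -/
theorem tab4_iff (hW : IsStdArith W) (hK1 : 1 ≤ K) (hbd : (boundE ar d p q).Bdd n K) :
    Tab4 M ar K p q W ↔ ∀ j : ℕ, j < d * T + 3 * d → σ 0 (NN m P + 1 + j) (noneVal M.tm) := by
  have hm : (codeLenE ar).eval n = m := eval_codeLenE R
  obtain ⟨-, -, -, hNNE, -, hdTE, -, -, -, hn, hbig⟩ := bounds_of_boundE hbd hm
  have hNN : NN m P = 2 * m + 2 + P := rfl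
  have hc0 : (const 0).Bdd n K := show 0 < n ^ K by omega
  have hgE : (add (dTE ar d p q) (const (3 * d))).Bdd n K :=
    ⟨hdTE, show 3 * d < n ^ K by omega, by simp only [NExpr.eval, eval_dTE hm]; omega⟩
  have hgv : (add (dTE ar d p q) (const (3 * d))).eval n = d * T + 3 * d := by
    simp only [NExpr.eval, eval_dTE hm]
  have hNN1 : (add (NNE ar p) (const 1)).Bdd n K :=
    ⟨hNNE, show 1 < n ^ K by omega, by simp only [NExpr.eval, eval_NNE hm]; omega⟩
  have e : ∀ jj : Fin K → Fin n, tval jj < d * T + 3 * d →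
      (AtN W (noneVal M.tm) (const 0) [] (add (NNE ar p) (const 1)) [jj] ↔
        σ 0 (NN m P + 1 + tval jj) (noneVal M.tm)) :=
    fun jj hj => atN_iff' hW hK1 hc0 hNN1 (a := 0) (b := NN m P + 1 + tval jj) (by simp [NExpr.eval])
      (by simp [NExpr.eval, eval_NNE hm]) (by omega) (by omega)
  unfold Tab4
  constructor
  · intro h4 j hj
    have hjK : j < n ^ K := by omega
    have h := h4 (tupOf j hjK) ((ltE_iff hW hK1 hgE _).2 (by rw [tval_tupOf, hgv]; exact hj))
    rwa [e _ (by rw [tval_tupOf]; exact hj), tval_tupOf] at h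
  · intro H jj hg
    have hj : tval jj < d * T + 3 * d := by have := (ltE_iff hW hK1 hgE jj).1 hg; rwa [hgv] at this
    exact (e jj hj).2 (H _ hj)

/-- **Family 5 is the top rule.** [Sipser 2012, Thm. 7.37; Libkin 2004, p. 171] [folklore] -/
theorem tab5_iff (hW : IsStdArith W) (hK1 : 1 ≤ K) (hbd : (boundE ar d p q).Bdd n K) :
    Tab5 M ar K p q W ↔
      ∀ t : ℕ, t < T → ∀ (a : Fin (3 * d + 1) → Val M.tm) (r : Fin (2 * d + 1)),
        (∀ s : Fin (3 * d + 1), σ t s (a s)) → σ (t + 1) r (topF d a r) := by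
  have hm : (codeLenE ar).eval n = m := eval_codeLenE R
  obtain ⟨-, -, -, -, hTE, -, -, -, -, hn, hbig⟩ := bounds_of_boundE hbd hm
  have hNN : NN m P = 2 * m + 2 + P := rfl
  have hTv : (TE ar p q).eval n = T := eval_TE hm
  have hc0 : (const 0).Bdd n K := show 0 < n ^ K by omega
  have hc1 : (const 1).Bdd n K := show 1 < n ^ K by omega
  have hcs : ∀ s : Fin (3 * d + 1), (const (s : ℕ)).Bdd n K := fun s =>
    show (s : ℕ) < n ^ K by have := s.2; omega
  have hcr : ∀ r : Fin (2 * d + 1), (const (r : ℕ)).Bdd n K := fun r =>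
    show (r : ℕ) < n ^ K by have := r.2; omega
  unfold Tab5
  constructor
  · intro h5 t ht a r hs
    have htK : t < n ^ K := by omega
    have h := h5 (tupOf t htK) ((ltE_iff hW hK1 hTE _).2 (by rw [tval_tupOf, hTv]; exact ht)) a r
      fun s => (atN_iff' hW hK1 hc0 (hcs s) (a := t) (b := s) (by simp [NExpr.eval])
        (by simp [NExpr.eval]) htK (hcs s)).2 (hs s)
    exact (atN_iff' hW hK1 hc1 (hcr r) (a := t + 1) (b := r) (by simp [NExpr.eval]; omega)
      (by simp [NExpr.eval]) (by omega) (hcr r)).1 h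
  · intro H tt hlt a r hs
    have ht : tval tt < T := by have := (ltE_iff hW hK1 hTE tt).1 hlt; rwa [hTv] at this
    refine (atN_iff' hW hK1 hc1 (hcr r) (a := tval tt + 1) (b := r) (by simp [NExpr.eval]; omega)
      (by simp [NExpr.eval]) (by omega) (hcr r)).2 ?_
    exact H (tval tt) ht a r fun s => (atN_iff' hW hK1 hc0 (hcs s) (a := tval tt) (b := s)
      (by simp [NExpr.eval]) (by simp [NExpr.eval]) (by have := tval_lt tt; omega) (hcs s)).1 (hs s)

/-- **Family 6 is the interior rule.** [Sipser 2012, Thm. 7.37; Libkin 2004, p. 171] [folklore] -/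
theorem tab6_iff (hW : IsStdArith W) (hK1 : 1 ≤ K) (hbd : (boundE ar d p q).Bdd n K) :
    Tab6 M ar K p q W ↔
      ∀ t : ℕ, t < T → ∀ j : ℕ, j < NN m P + d * T →
        ∀ (h : Fin (d + 1) → Val M.tm) (nb : Fin (2 * d + 1) → Val M.tm),
          (∀ s : Fin (d + 1), σ t s (h s)) →
          (∀ s : Fin (2 * d + 1), σ t (d + 1 + j + s) (nb s)) →
            σ (t + 1) (2 * d + 1 + j) (intF d h nb) := by
  have hm : (codeLenE ar).eval n = m := eval_codeLenE R
  obtain ⟨-, -, -, -, hTE, -, hNNdTE, -, -, hn, hbig⟩ := bounds_of_boundE hbd hm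
  have hgv : (NNdTE ar d p q).eval n = NN m P + d * T := eval_NNdTE hm
  have hNN : NN m P = 2 * m + 2 + P := rfl
  have hTv : (TE ar p q).eval n = T := eval_TE hm
  have hc0 : (const 0).Bdd n K := show 0 < n ^ K by omega
  have hc1 : (const 1).Bdd n K := show 1 < n ^ K by omega
  have hc2d : (const (2 * d + 1)).Bdd n K := show 2 * d + 1 < n ^ K by omega
  have hcs : ∀ s : Fin (d + 1), (const (s : ℕ)).Bdd n K := fun s =>
    show (s : ℕ) < n ^ K by have := s.2; omega
  have hcs' : ∀ s : Fin (2 * d + 1), (const (d + 1 + s : ℕ)).Bdd n K := fun s =>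
    show d + 1 + (s : ℕ) < n ^ K by have := s.2; omega
  unfold Tab6
  constructor
  · intro h6 t ht j hj hh nb hhs hnbs
    have htK : t < n ^ K := by omega
    have hjK : j < n ^ K := by omega
    have h := h6 (tupOf t htK) ((ltE_iff hW hK1 hTE _).2 (by rw [tval_tupOf, hTv]; exact ht))
      (tupOf j hjK) ((ltE_iff hW hK1 hNNdTE _).2 (by rw [tval_tupOf, hgv]; exact hj)) hh nb
      (fun s => (atN_iff' hW hK1 hc0 (hcs s) (a := t) (b := s) (by simp [NExpr.eval])
        (by simp [NExpr.eval]) htK (hcs s)).2 (hhs s))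
      (fun s => (atN_iff' hW hK1 hc0 (hcs' s) (a := t) (b := d + 1 + j + s) (by simp [NExpr.eval])
        (by simp [NExpr.eval]; omega) htK (by have := s.2; omega)).2 (hnbs s))
    exact (atN_iff' hW hK1 hc1 hc2d (a := t + 1) (b := 2 * d + 1 + j) (by simp [NExpr.eval]; omega)
      (by simp [NExpr.eval]) (by omega) (by omega)).1 h
  · intro H tt hgt jj hgj hh nb hhs hnbs
    have ht : tval tt < T := by have := (ltE_iff hW hK1 hTE tt).1 hgt; rwa [hTv] at this
    have hj : tval jj < NN m P + d * T := by
      have := (ltE_iff hW hK1 hNNdTE jj).1 hgj; rwa [hgv] at this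
    refine (atN_iff' hW hK1 hc1 hc2d (a := tval tt + 1) (b := 2 * d + 1 + tval jj)
      (by simp [NExpr.eval]; omega) (by simp [NExpr.eval]) (by omega) (by omega)).2 ?_
    exact H (tval tt) ht (tval jj) hj hh nb
      (fun s => (atN_iff' hW hK1 hc0 (hcs s) (a := tval tt) (b := s) (by simp [NExpr.eval])
        (by simp [NExpr.eval]) (by omega) (hcs s)).1 (hhs s))
      (fun s => (atN_iff' hW hK1 hc0 (hcs' s) (a := tval tt) (b := d + 1 + tval jj + s)
        (by simp [NExpr.eval]) (by simp [NExpr.eval]; omega) (by omega)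
        (by have := s.2; omega)).1 (hnbs s))

/-- **Family 7 is the empty bottom.** [Sipser 2012, Thm. 7.37] [folklore] -/
theorem tab7_iff (hW : IsStdArith W) (hK1 : 1 ≤ K) (hbd : (boundE ar d p q).Bdd n K) :
    Tab7 M ar K p q W ↔
      ∀ t : ℕ, t < T → ∀ r : ℕ, r < d →
        σ (t + 1) (NN m P + d * T + 2 * d + 1 + r) (noneVal M.tm) := by
  have hm : (codeLenE ar).eval n = m := eval_codeLenE R
  obtain ⟨-, -, -, -, hTE, -, hNNdTE, -, -, hn, hbig⟩ := bounds_of_boundE hbd hm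
  have hgv : (NNdTE ar d p q).eval n = NN m P + d * T := eval_NNdTE hm
  have hNN : NN m P = 2 * m + 2 + P := rfl
  have hTv : (TE ar p q).eval n = T := eval_TE hm
  have hc1 : (const 1).Bdd n K := show 1 < n ^ K by omega
  have hbE : ∀ r : Fin d, (add (NNdTE ar d p q) (const (2 * d + 1 + r))).Bdd n K := fun r =>
    ⟨hNNdTE, show 2 * d + 1 + (r : ℕ) < n ^ K by have := r.2; omega,
      by simp only [NExpr.eval, hgv]; have := r.2; omega⟩
  have e : ∀ (tt : Fin K → Fin n) (r : Fin d), tval tt < T →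
      (AtN W (noneVal M.tm) (const 1) [tt] (add (NNdTE ar d p q) (const (2 * d + 1 + r))) [] ↔
        σ (tval tt + 1) (NN m P + d * T + 2 * d + 1 + r) (noneVal M.tm)) :=
    fun tt r ht => atN_iff' hW hK1 hc1 (hbE r) (a := tval tt + 1) (b := NN m P + d * T + 2 * d + 1 + r)
      (by simp [NExpr.eval]; omega) (by simp [NExpr.eval, hgv]; omega) (by omega) (by have := r.2; omega)
  unfold Tab7
  constructor
  · intro h7 t ht r hr
    have htK : t < n ^ K := by omega
    have h := h7 (tupOf t htK) ((ltE_iff hW hK1 hTE _).2 (by rw [tval_tupOf, hTv]; exact ht)) ⟨r, hr⟩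
    rwa [e _ _ (by rw [tval_tupOf]; exact ht), tval_tupOf] at h
  · intro H tt hgt r
    have ht : tval tt < T := by have := (ltE_iff hW hK1 hTE tt).1 hgt; rwa [hTv] at this
    exact (e tt r ht).2 (H _ ht r r.2)

/-- **Family 8 is the exactly-one family.** [Sipser 2012, Thm. 7.37] [folklore] -/
theorem tab8_iff (hW : IsStdArith W) (hK1 : 1 ≤ K) (hbd : (boundE ar d p q).Bdd n K) :
    Tab8 M ar K p q W ↔
      ∀ t : ℕ, t ≤ T → ∀ J : ℕ, J ≤ S1 M m P T →
        (∃ v, σ t J v) ∧ ∀ v v', v ≠ v' → ¬ (σ t J v ∧ σ t J v') := by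
  have hm : (codeLenE ar).eval n = m := eval_codeLenE R
  obtain ⟨-, -, -, -, hTE, -, -, hS1E, -, hn, hbig⟩ := bounds_of_boundE hbd hm
  have hSv : (S1E ar d p q).eval n = S1 M m P T := by rw [eval_S1E hm]; rfl
  have hS1 : S1 M m P T = 2 * m + 2 + P + d * T + 3 * d := rfl
  have hNN : NN m P = 2 * m + 2 + P := rfl
  have hTv : (TE ar p q).eval n = T := eval_TE hm
  have hc0 : (const 0).Bdd n K := show 0 < n ^ K by omega
  have e : ∀ (v : Val M.tm) (tt JJ : Fin K → Fin n),
      (AtN W v (const 0) [tt] (const 0) [JJ] ↔ σ (tval tt) (tval JJ) v) :=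
    fun v tt JJ => atN_iff' hW hK1 hc0 hc0 (a := tval tt) (b := tval JJ) (by simp [NExpr.eval])
      (by simp [NExpr.eval]) (tval_lt tt) (tval_lt JJ)
  unfold Tab8
  constructor
  · intro h8 t ht J hJ
    have htK : t < n ^ K := by omega
    have hJK : J < n ^ K := by omega
    obtain ⟨⟨v, hv⟩, hall⟩ := h8 (tupOf t htK) ((leE_iff hW hK1 hTE _).2 (by rw [tval_tupOf, hTv]; exact ht))
      (tupOf J hJK) ((leE_iff hW hK1 hS1E _).2 (by rw [tval_tupOf, hSv]; exact hJ))
    simp only [e, tval_tupOf] at hv hall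
    refine ⟨⟨v, hv⟩, fun v v' hne hboth => ?_⟩
    rcases hall (v, v') with heq | hnot
    · exact hne heq
    · exact hnot hboth
  · intro H tt hgt JJ hgJ
    have ht : tval tt ≤ T := by have := (leE_iff hW hK1 hTE tt).1 hgt; rwa [hTv] at this
    have hJ : tval JJ ≤ S1 M m P T := by have := (leE_iff hW hK1 hS1E JJ).1 hgJ; rwa [hSv] at this
    obtain ⟨⟨v, hv⟩, hall⟩ := H _ ht _ hJ
    simp only [e]
    refine ⟨⟨v, hv⟩, fun vv => ?_⟩
    by_cases heq : vv.1 = vv.2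
    · exact Or.inl heq
    · exact Or.inr (hall _ _ heq)

/-- **Family 9 is acceptance.** [Sipser 2012, Thm. 7.37] [folklore] -/
theorem tab9_iff (hW : IsStdArith W) (hK1 : 1 ≤ K) (hbd : (boundE ar d p q).Bdd n K) : Tab9 M ar K p q W ↔ σ T 1 (accVal M) := by
  have hm : (codeLenE ar).eval n = m := eval_codeLenE R
  obtain ⟨-, -, -, -, hTE, -, -, -, -, hn, hbig⟩ := bounds_of_boundE hbd hm
  have hNN : NN m P = 2 * m + 2 + P := rfl
  have hTv : (TE ar p q).eval n = T := eval_TE hm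
  unfold Tab9
  exact atN_iff' hW hK1 hTE (show (const 1).Bdd n K from show 1 < n ^ K by omega) (a := T) (b := 1)
    (by simp [hTv]) (by simp [NExpr.eval]) (by omega) (by omega)

/-- **Correctness of `Ψ`**: over standard arithmetic (and a large enough width `K`), the tableau
query holds iff the Cook–Levin families hold for the `σ` read off the witness tables.
[Libkin 2004, proof of Thm. 9.6, pp. 171–173; Sipser 2012, Thm. 7.37] [folklore] -/
theorem tabP_iff (hW : IsStdArith W) (hK1 : 1 ≤ K) (hbd : (boundE ar d p q).Bdd n K) : TabP M ar K p q hK W R ↔ ClausesHoldS M (codeOf R) P T σ := by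
  unfold TabP ClausesHoldS
  exact and_congr (tab1_iff R hW hK1 hbd) (and_congr (tab2_iff R hW hK1 hbd)
    (and_congr (tab3_iff R hW hK1 hbd) (and_congr (tab4_iff R hW hK1 hbd)
    (and_congr (tab5_iff R hW hK1 hbd) (and_congr (tab6_iff R hW hK1 hbd)
    (and_congr (tab7_iff R hW hK1 hbd) (and_congr (tab8_iff R hW hK1 hbd) (tab9_iff R hW hK1 hbd))))))))

end Correctness

/-! ### Assembly: `NP ⊆ ∃SO` -/

section Assembly

variable (M : Turing.TM2ComputableAux Bool Bool) (ar : List ℕ) (K : ℕ) (p q : Polynomial ℕ)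
  (hK : ∀ s : Fin ar.length, ar.get s ≤ K)

attribute [local instance] Turing.FinTM2.kFin Turing.FinTM2.ΛFin Turing.FinTM2.σFin
  Turing.FinTM2.Γk₀Fin

/-- **Fagin's sentence defines the class on large structures.** If membership of the codes in
`L` is solvability of the Cook–Levin families of `M` (bounds `p`, `q`), then for an
isomorphism-closed class `C` with language of codes `L` and every structure with `n ≥ 2`
elements (and a width `K` bounding the master numeral): `⟨n, R⟩ ∈ C` iff SOME witness tables
satisfy the arithmetic axioms and `Ψ`. (⇒: the standard arithmetic tables on top of the tables of
a satisfying assignment; ⇐: normalise the guessed order to `<` by a relabelling `π` of `Fin n`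
— `Ψ` is isomorphism-invariant, being first-order — read an assignment off the tables, conclude
`⟨n, π·R⟩ ∈ C`, and use isomorphism-closure.) [Libkin 2004, proof of Thm. 9.6, pp. 170–173;
Immerman 1999, Thm. 7.8] [folklore] -/
theorem mem_iff_exists_faginQ {C : Set (SNPInstance ar)} (hC : IsIsoClosedStr ar C)
    (hL : ∀ x : List Bool, x ∈ (encodingSNPInstance ar).toLanguage C ↔
      ∃ τ, ClausesHold M x (p.eval x.length) (faginT p q x.length) τ)
    (hK1 : 1 ≤ K) (hb : ∀ n : ℕ, 2 ≤ n → (boundE ar (dM M) p q).Bdd n K) {n : ℕ} (hn : 2 ≤ n)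
    (R : RelTables ar n) :
    (⟨n, R⟩ : SNPInstance ar) ∈ C ↔
      ∃ W : RelTables (arithWit K (tabWit M K)) n, faginQ M ar K p q hK R W Empty.elim := by
  have hbd := hb n hn
  -- rows `≤ T` and blocks `≤ S₁` are tuple numbers (the code length does not depend on `R`)
  have hsmall : ∀ R' : RelTables ar n, ∀ t, t ≤ faginT p q (codeOf R').length →
      ∀ J, J ≤ S1 M (codeOf R').length (p.eval (codeOf R').length) (faginT p q (codeOf R').length) →
        t < n ^ K ∧ J < n ^ K := by
    intro R' t ht J hJ
    have hbig := (bounds_of_boundE hbd (eval_codeLenE R')).2.2.2.2.2.2.2.2.2.2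
    have hS1 : S1 M (codeOf R').length (p.eval (codeOf R').length) (faginT p q (codeOf R').length) =
        NN (codeOf R').length (p.eval (codeOf R').length) + dM M * faginT p q (codeOf R').length +
          3 * dM M := rfl
    omega
  constructor
  · intro hR
    have hx : codeOf R ∈ (encodingSNPInstance ar).toLanguage C :=
      (Computability.Encoding.mem_toLanguage_iff _ C ⟨n, R⟩).2 hR
    obtain ⟨τ, hτ⟩ := (hL _).1 hx
    refine ⟨stdArith K (relsOf (blk M (codeOf R).length (p.eval (codeOf R).length)
      (faginT p q (codeOf R).length)) τ), arithAxP_stdArith _, ?_⟩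
    rw [tabP_iff R (isStdArith_stdArith _) hK1 hbd, restT_stdArith]
    rw [clausesHold_iff_clausesHoldS] at hτ
    refine (clausesHoldS_congr (M := M) _ _ _ fun t ht J hJ v => ?_).1 hτ
    rw [sigmaW_relsOf]
    have h2 := hsmall R t ht J hJ
    exact ⟨fun h => ⟨h2.1, h2.2, h⟩, fun h => h.2.2⟩
  · rintro ⟨W, hA, hT⟩
    obtain ⟨π, hπ⟩ := exists_relabel_isStdArith hA
    have hQ : faginQ M ar K p q hK (relabelTables R π) (relabelTables W π) (π ∘ Empty.elim) :=
      ((JQuery.isDef_faginQ M ar K p q hK).invariant R W Empty.elim π).2 ⟨hA, hT⟩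
    obtain ⟨-, hT'⟩ := hQ
    rw [tabP_iff (relabelTables R π) hπ hK1 hbd] at hT'
    have hCH : ClausesHold M (codeOf (relabelTables R π)) (p.eval (codeOf (relabelTables R π)).length)
        (faginT p q (codeOf (relabelTables R π)).length)
        (assignOf (RB M (codeOf (relabelTables R π)).length (p.eval (codeOf (relabelTables R π)).length)
          (faginT p q (codeOf (relabelTables R π)).length)) (SigmaW (restT (relabelTables W π)))) := by
      rw [clausesHold_iff_clausesHoldS]
      refine (clausesHoldS_congr (M := M) _ _ _ fun t _ J hJ v => ?_).2 hT'
      exact assignOf_blk _ _ _ _ (Nat.lt_succ_of_le hJ) v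
    have hx' : codeOf (relabelTables R π) ∈ (encodingSNPInstance ar).toLanguage C := (hL _).2 ⟨_, hCH⟩
    exact (hC n R π).2 ((Computability.Encoding.mem_toLanguage_iff _ C ⟨n, relabelTables R π⟩).1 hx')

end Assembly

/-- **Fagin's theorem, hard direction `NP ⊆ ∃SO`** (discharge of `NP_subset_eso` of
`Fagin.lean`): over any relational vocabulary, every isomorphism-closed class of finite
structures whose language of codes is in `NP` is `∃SO`-definable. Proof: unpack `NP` into a
`FinTM2` verifier and polynomials (`exists_clausesHold_of_mem_NP`: membership = solvability of
the Cook–Levin families), choose the width `K` (`exists_width`), hard-wire the structures with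
`< 2` elements (`IsESODefinable.of_eventually`) and use Fagin's sentence on the rest
(`mem_iff_exists_faginQ`). Non-degeneracy of the vocabulary is not needed in this direction.
[Libkin 2004, Thm. 9.6 (proof, second part, pp. 170–173); Immerman 1999, Thm. 7.8; Fagin 1974]
[cite: Libkin2004, Thm. 9.6 (proof, second part, pp. 170–173)] -/
theorem NP_subset_eso_holds : NP_subset_eso := by
  intro ar C _ hC hNP
  obtain ⟨M, p, q, hL⟩ := exists_clausesHold_of_mem_NP hNP
  obtain ⟨K, hK1, hKar, hb⟩ := exists_width ar (dM M) p q
  exact IsESODefinable.of_eventually hC 2 (JQuery.isDef_faginQ M ar K p q hKar)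
    fun n hn R => mem_iff_exists_faginQ M ar K p q hKar hC hL hK1 hb hn R

end Literature.ModelTheory.FiniteModelTheory
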